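import Literature.AlgebraicGeometry.Resolution.KangarooAtlasCert
/-!
# Kangaroo atlas — the Cossart–Schober polygon invariant `ι_poly = (β, γ, σ, α)`, computable twin and certified rows

[CS20] = V. Cossart, B. Schober, *A strictly decreasing invariant for resolution of singularities in dimension
two*, Publ. RIMS 56 (2020) 217–280 = arXiv:1411.4452: for a two-dimensional characteristic polyhedron
`Δ = Δ(J; u₁, u₂)` and a boundary component `V(u₁)` the numbers (Def. 3.2 / (3.1), p. 21 of the arXiv version)
`α₁ = inf v₁`, `β₁ = inf {v₂ : (α₁, v₂) ∈ Δ}`, `γ₁ = sup {v₂ : (δ − v₂, v₂) ∈ Δ}` (`δ = inf (v₁ + v₂)`),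
`s₁(u₂) = −1/slope` of the first edge `v⁽¹⁾v⁽²⁾` (`∞` if `Δ` has one vertex), the supremum
`σ₁ = 1` if `β₁ < 1`, else `sup {1, sup_{u₂} s₁(u₂)}` ((5.1) before Def. 5.5), and the invariant
`ι_poly = (β₁, γ₁, σ₁, α₁)` of a NEW boundary component (`inf_lex` of both tuples when both components are new,
`(∞, ∞, ∞, ∞)` when there is none, `(0,0,0,0)` when `e = 0`; Def. 5.1, Def. 5.5), which DROPS for the
lexicographic order under the blow-ups of the CJS strategy as long as `(ι₀, ι_c)` is unchanged (Prop. 5.7),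
but may increase when `σ` is replaced by `s(u₂)` in given coordinates (Ex. 5.6).

This file is the kernel-checkable TWIN of the cell's Python preview (`pub-rosobs-carver-g7/preview/poly_core.py`)
for the hypersurfaces `x^q + F(y, z)` of the kangaroo atlas (`KangarooAtlasCert.lean`: `F` cleaned of `q`-th power
monomials, states `⟨F, r⟩`, blow-up `step`).  DICTIONARY (the cell's reading, INVARIANTS-g7 §45–§51, not a statement
of [CS20]): for `F` cleaned, `Δ(x^q + F; u_i, u_o; x) = conv(supp F)/q + ℝ²_{≥0}` (no vertex is solvable over a
perfect field), so all numbers are read off the exponent list and are kept SCALED BY `q` (naturals); the new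
components are `N = {i : r_i > 0}`; `σ_i` is computed over `𝔽_p` as the supremum of `s_i` over the substitutions
`u_o ↦ u_o + φ(u_i)`, `φ ∈ 𝔽_p[u_i]`, `φ(0) = 0` followed by re-cleaning (search space FP-σ of the notes — [CS20]
take the supremum over all `ū₂`; their realising coordinates in Ex. 5.6 and in the proof of Prop. 5.7,
`u₂ ∓ λu₁`, lie in FP-σ), by the ROOT PROCEDURE `sSupQ` (greedy chains of improving substitutions of order
`n = s ∈ ℤ`; INVARIANTS-g7 §49 proves that within FP-σ nothing else can raise `s`).
CERTIFIED ROWS (`decide`): the printed numbers of [CS20] Ex. 5.6 ((5.2), (5.3), the value `(3/2, 3/2, 7/3, 0)`) and of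
the `s`-dependence example of [CS20] p. 21; `ι_poly` along Hauser's kangaroo path [Hauser 2010, §G] (the CJS centre
there is a curve from the first blow-up on: `α ≥ 1`; at the kangaroo point `β` drops `5/2 → 3/2` while the shade
rises `2 → 3`); the two prescribed-history zoo rows; the smallest atlas witness of an increase of `ι_poly` under a
point blow-up at which CJS would blow up a curve.  A CERTIFICATE of finitely many computations and a typing of the
value type / event predicate — not a theorem about resolution; AI-reviewed only (see the caveat of
`KangarooAtlasCertKangarooIota.lean`).
-/

namespace Literature.AlgebraicGeometry.Resolution.KangarooAtlasCert

/-! ## The projected support and the vertices of the polygon (surface case `m = 2`) -/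

/-- for the boundary index `i ∈ {0, 1}` (variable `u_i`; the other one is `u_o`, `o = 1 − i`): the exponent pairs
`(a_i, a_o)` of the support of `F`; `Δ(x^q + F; u_i, u_o; x) = conv((1/q)·supp2) + ℝ²_{≥0}` for `F` cleaned.
[cite: CossartSchober2020, Def. 3.4–3.5 (well-prepared); Hironaka 1967] -/
def supp2 (i : ℕ) (F : Poly) : List (ℕ × ℕ) := F.map (fun t => (t.1.getD i 0, t.1.getD (1 - i) 0))

/-- the vertex `v⁽¹⁾ = (qα, qβ)`: leftmost column, lowest point on it. [cite: CossartSchober2020, (3.1)] -/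
def vtx1 (P : List (ℕ × ℕ)) : Option (ℕ × ℕ) :=
  P.foldl (fun acc x => match acc with
    | none => some x
    | some v => if x.1 < v.1 ∨ (x.1 = v.1 ∧ x.2 < v.2) then some x else some v) none

/-- the next vertex of the compact boundary after `cur`: among the support points strictly below `cur`, the one of
least `Δa/Δb` (ties: the lowest), i.e. the far end of the edge leaving `cur`. [folklore] -/
def nextVtx (cur : ℕ × ℕ) (P : List (ℕ × ℕ)) : Option (ℕ × ℕ) :=
  (P.filter (fun x => x.2 < cur.2 ∧ cur.1 ≤ x.1)).foldl (fun acc x => match acc with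
    | none => some x
    | some v =>
        if (x.1 - cur.1) * (cur.2 - v.2) < (v.1 - cur.1) * (cur.2 - x.2) ∨
            ((x.1 - cur.1) * (cur.2 - v.2) = (v.1 - cur.1) * (cur.2 - x.2) ∧ x.2 < v.2) then some x else some v) none

/-- the vertices `v⁽¹⁾, v⁽²⁾, …` of the compact boundary, from the leftmost (fuel-bounded recursion). [folklore] -/
def vertsFrom (P : List (ℕ × ℕ)) : ℕ → (ℕ × ℕ) → List (ℕ × ℕ)
  | 0, cur => [cur]
  | fuel + 1, cur =>
      match nextVtx cur P with
      | none => [cur]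
      | some v => cur :: vertsFrom P fuel v

/-- slope datum of the first edge: `none` = `∞` (one vertex), `some (num, den)` = `s = num/den` with
`num = q(v⁽²⁾₁ − v⁽¹⁾₁)`, `den = q(v⁽¹⁾₂ − v⁽²⁾₂) > 0`. [cite: CossartSchober2020, Def. 3.2 (4)] -/
abbrev SVal := Option (ℕ × ℕ)

/-- `a < b` on slope data (cross-multiplication; `∞` is the top). [folklore] -/
def SVal.lt : SVal → SVal → Bool
  | some a, some b => decide (a.1 * b.2 < b.1 * a.2)
  | some _, none => true
  | none, _ => false

/-- `a = b` as extended rationals. [folklore] -/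
def SVal.beq' : SVal → SVal → Bool
  | some a, some b => decide (a.1 * b.2 = b.1 * a.2)
  | none, none => true
  | _, _ => false

/-- maximum of two slope data. [folklore] -/
def SVal.max (a b : SVal) : SVal := if SVal.lt a b then b else a

/-- the polygon numbers of `Δ(x^q + F; u_i, u_o; x)`, all SCALED BY `q`: `deltaQ = qδ = ord F`, `alphaQ = qα_i`,
`betaQ = qβ_i`, `gammaQ = qγ_i` (highest point of the line `a + b = qδ`), `gammaLoQ = qγ_i⁻` (its lowest point),
`s` (first edge), `nvert` (number of vertices). [cite: CossartSchober2020, Def. 3.2, (3.1)] -/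
structure PNums where
  deltaQ : ℕ
  alphaQ : ℕ
  betaQ : ℕ
  gammaQ : ℕ
  gammaLoQ : ℕ
  s : SVal
  nvert : ℕ
  deriving Repr, DecidableEq

/-- read the polygon numbers for the boundary index `i` off the cleaned exponent list. [cite: CossartSchober2020, Def. 3.2] -/
def pnums (i : ℕ) (F : Poly) : PNums :=
  let P := supp2 i F
  let d := ord F
  match vtx1 P with
  | none => ⟨d, 0, 0, 0, 0, none, 0⟩
  | some v =>
      let onLine := (P.filter (fun x => x.1 + x.2 = d)).map (fun x => x.2)
      let vs := vertsFrom P P.length v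
      let s : SVal := match vs with
        | _ :: w :: _ => some (w.1 - v.1, v.2 - w.2)
        | _ => none
      ⟨d, v.1, v.2, onLine.foldl max 0, onLine.foldl min d, s, vs.length⟩

/-! ## `σ`: the root procedure over `𝔽_p` (search space FP-σ: `u_o ↦ u_o + c·u_iⁿ`, re-cleaned) -/

/-- the substitution `u_o ↦ u_o + c·u_iⁿ` (binomial theorem mod `p`) followed by the cleaning of `q`-th powers.
[cite: CossartSchober2020, Ex. 5.6 (`v₂ = u₂ + λu₁`)] -/
def substClean (p q i n c : ℕ) (F : Poly) : Poly :=
  clean q (normalize p (F.flatMap (fun t =>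
    let a := t.1.getD i 0
    let b := t.1.getD (1 - i) 0
    (List.range (b + 1)).map (fun k =>
      ((t.1.set i (a + n * k)).set (1 - i) (b - k), t.2 * Nat.choose b k * c ^ k)))))

/-- supremum of `s_i` over greedy chains of IMPROVING substitutions of order `n = s` (only an integer `s` can be
raised, and only by `n = s`: INVARIANTS-g7 §49); fuel-bounded (every improvement strictly raises `s`). [folklore] -/
def sSupQ (p q i : ℕ) : ℕ → Poly → SVal
  | 0, F => (pnums i F).s
  | fuel + 1, F =>
      match (pnums i F).s with
      | none => none
      | some sd =>
          if sd.1 % sd.2 = 0 then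
            ((List.range p).filter (fun c => c ≠ 0)).foldl
              (fun acc c =>
                let F' := substClean p q i (sd.1 / sd.2) c F
                if SVal.lt (some sd) (pnums i F').s then SVal.max acc (sSupQ p q i fuel F') else acc)
              (some sd)
          else some sd

/-- `σ_i` over `𝔽_p` within FP-σ: `1` if `β_i < 1` (`qβ_i < q`), else `max(1, sup s_i)`.
[cite: CossartSchober2020, (5.1) before Def. 5.5] -/
def sigmaQ (p q i fuel : ℕ) (F : Poly) : SVal :=
  if (pnums i F).betaQ < q then some (1, 1) else SVal.max (some (1, 1)) (sSupQ p q i fuel F)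

/-! ## The value type of `ι_poly` and the event predicate -/

/-- `ι_poly` scaled by `q`: `(qβ, qγ, σ-or-s, qα)`; `Option IotaPoly` with `none = (∞, ∞, ∞, ∞)`.
[cite: CossartSchober2020, Def. 5.5] -/
abbrev IotaPoly := ℕ × ℕ × SVal × ℕ

/-- equality of slope data is decidable (for `decide` rows). [folklore] -/
instance : DecidableEq SVal := inferInstanceAs (DecidableEq (Option (ℕ × ℕ)))

/-- equality of `ι_poly` values is decidable (for `decide` rows). [folklore] -/
instance : DecidableEq IotaPoly := inferInstanceAs (DecidableEq (ℕ × ℕ × SVal × ℕ))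

/-- strict lexicographic order on `(β, γ, σ, α)`. [cite: CossartSchober2020, Def. 5.5] -/
def IotaPoly.lt (a b : IotaPoly) : Bool :=
  decide (a.1 < b.1) || (decide (a.1 = b.1) && (decide (a.2.1 < b.2.1) || (decide (a.2.1 = b.2.1) &&
    (SVal.lt a.2.2.1 b.2.2.1 || (SVal.beq' a.2.2.1 b.2.2.1 && decide (a.2.2.2 < b.2.2.2))))))

/-- the new boundary components of a state: `N = {i : r_i > 0}` (reading FP-N of the notes: every component
recorded in `r`, including a prescribed history `r₀`, is NEW for the singularity). [cite: CossartSchober2020, Def. 4.2] -/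
def newN (s : State) : List ℕ := (List.range s.r.length).filter (fun i => s.r.getD i 0 ≠ 0)

/-- `ι_poly` of a state with `|N| ≥ 0` new components among `y, z`; `useSigma = false` puts the coordinate-dependent
`s_i` of the given exceptional coordinates in the third slot (the tuple (5.2) of [CS20] Ex. 5.6), `true` puts `σ_i`
(root procedure, fuel `fuel`).  `e = 0` (`ord F = q`) gives `(0,0,0,0)` (Def. 5.1), `N = ∅` gives `∞` (Def. 5.5).
[cite: CossartSchober2020, Def. 5.1, Def. 5.5] -/
def iotaPoly (p q fuel : ℕ) (useSigma : Bool) (s : State) : Option IotaPoly :=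
  if ord s.F = q then some (0, 0, some (0, 1), 0)
  else
    (newN s).foldl (fun acc i =>
      let P := pnums i s.F
      let v : IotaPoly := (P.betaQ, P.gammaQ, (if useSigma then sigmaQ p q i fuel s.F else P.s), P.alphaQ)
      match acc with
      | none => some v
      | some w => if IotaPoly.lt v w then some v else some w) none

/-- the three events of an edge `x ← x'`. [folklore] -/
inductive Ev | drop | stall | increase
  deriving DecidableEq, Repr

/-- compare `ι_poly(x')` (first argument) with `ι_poly(x)`: `drop` iff strictly smaller in the lexicographic order,
`∞` on top. [cite: CossartSchober2020, Prop. 5.7] -/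
def evOf : Option IotaPoly → Option IotaPoly → Ev
  | none, none => .stall
  | none, some _ => .increase
  | some _, none => .drop
  | some a, some b => if IotaPoly.lt a b then .drop else if IotaPoly.lt b a then .increase else .stall

/-- the event predicate "ι_poly drops at the step `(chart j, point b)` from the state `s`" (false if the step is not
equimultiple). [cite: CossartSchober2020, Prop. 5.7] -/
def IotaPolyDrops (p q fuel : ℕ) (s : State) (j : ℕ) (b : List ℕ) : Prop :=
  ∃ s', step p q s j b = some s' ∧ evOf (iotaPoly p q fuel true s') (iotaPoly p q fuel true s) = Ev.drop

/-- the event predicate is decidable (the step and the comparison are computations). [folklore] -/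
instance (p q fuel : ℕ) (s : State) (j : ℕ) (b : List ℕ) : Decidable (IotaPolyDrops p q fuel s j b) := by
  unfold IotaPolyDrops
  cases h : step p q s j b with
  | none => exact isFalse (by simp)
  | some s' => exact decidable_of_iff (evOf (iotaPoly p q fuel true s') (iotaPoly p q fuel true s) = Ev.drop) (by simp)

/-- the CJS centre at a state is a CURVE `V(x, u_i)` iff some new component has `α_i ≥ 1` (`qα_i ≥ q`); otherwise
(all `α_i < 1`) the strategy blows up the closed point when it is isolated in the Hilbert–Samuel locus.
[cite: CossartSchober2020, proof of Prop. 5.7 (p. 30: "when |N(x)| = 1 then α₁ < 1 …")] -/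
def cjsCurve (q : ℕ) (s : State) : Bool := (newN s).any (fun i => decide (q ≤ (pnums i s.F).alphaQ))

/-- `(shade, ι_poly with σ, CJS-centre-is-a-curve)` along a scripted path of point blow-ups (`none` once a step fails). [folklore] -/
def iotaTrace (p q fuel : ℕ) (s : State) : List (ℕ × List ℕ) → List (Option (ℕ × Option IotaPoly × Bool))
  | [] => [some (shade s, iotaPoly p q fuel true s, cjsCurve q s)]
  | (j, b) :: rest =>
      match step p q s j b with
      | none => [some (shade s, iotaPoly p q fuel true s, cjsCurve q s), none]
      | some s' => some (shade s, iotaPoly p q fuel true s, cjsCurve q s) :: iotaTrace p q fuel s' rest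

/-! ## [CS20] Example 5.6: `h = y² + (u₂ + λu₁)³ + u₁⁷`, here over `𝔽₅` with `λ = 1` (variables `(u₁, u₂)`, `q = 2`) -/

/-- `(u₂ + u₁)³ + u₁⁷` expanded mod 5 (nothing to clean for `q = 2`). [cite: CossartSchober2020, Ex. 5.6] -/
def ex56F : Poly := [([0, 3], 1), ([1, 2], 3), ([2, 1], 3), ([3, 0], 1), ([7, 0], 1)]

/-- (5.2): in the given coordinates `(β₁, γ₁, s₁(u₂), α₁) = (3/2, 3/2, 1, 0)`: scaled `qβ = 3`, `qγ = 3`, `s = 3/3`,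
`qα = 0`; `qδ = 3`, two vertices. [cite: CossartSchober2020, Ex. 5.6 (5.2)] -/
theorem ex56_given : pnums 0 ex56F = ⟨3, 0, 3, 3, 0, some (3, 3), 2⟩ := by decide

/-- the same for the second component (the example is symmetric). [cite: CossartSchober2020, Ex. 5.6 (5.2)] -/
theorem ex56_given' : pnums 1 ex56F = ⟨3, 0, 3, 3, 0, some (3, 3), 2⟩ := by decide

/-- the supremum is attained at `v₂ = u₂ + λu₁`: the root procedure finds `u₂ ↦ u₂ + 4u₁` (`h = y² + v₂³ + u₁⁷`)
and `σ₁ = 7/3`, so `ι_poly(x) = (3/2, 3/2, 7/3, 0)`. [cite: CossartSchober2020, Ex. 5.6 (`ι_poly(x) = (3/2,3/2,7/3,0)`)] -/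
theorem ex56_sigma : sigmaQ 5 2 0 4 ex56F = some (7, 3) ∧ sigmaQ 5 2 1 4 ex56F = some (7, 3) := by decide

/-- the realising substitution explicitly: `u₂ ↦ u₂ − u₁` turns `F` into `u₂³ + u₁⁷`. [cite: CossartSchober2020, Ex. 5.6] -/
theorem ex56_subst : substClean 5 2 0 1 4 ex56F = [([0, 3], 1), ([7, 0], 1)] := by decide

/-- (5.3): blow up the origin, `U₁`-chart, the point `u₂/u₁ = −λ`: `h' = y'² + u₁v₂'³ + u₁⁵`, one new component
`V(u₁)`, `ι_poly(x') = (3/2, 3/2, 4/3, 1/2)` (here `s = σ = 4/3`): scaled `(3, 3, 4/3, 1)`.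
[cite: CossartSchober2020, Ex. 5.6 (5.3)] -/
theorem ex56_chart :
    (step 5 2 ⟨ex56F, [1, 1]⟩ 0 [0, 4]).map (fun s => (s.r, pnums 0 s.F, sigmaQ 5 2 0 4 s.F)) =
      some ([1, 0], ⟨4, 1, 3, 3, 3, some (4, 3), 2⟩, some (4, 3)) := by
  decide

/-- the point of the example: with `s(u₂)` in the third slot the tuple INCREASES, `(3,3,1,0) → (3,3,4/3,1)`,
with `σ` it DROPS, `(3,3,7/3,0) → (3,3,4/3,1)`. [cite: CossartSchober2020, Ex. 5.6] -/
theorem ex56_events :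
    ((step 5 2 ⟨ex56F, [1, 1]⟩ 0 [0, 4]).map (fun s' =>
        (evOf (iotaPoly 5 2 4 false s') (iotaPoly 5 2 4 false ⟨ex56F, [1, 1]⟩),
         evOf (iotaPoly 5 2 4 true s') (iotaPoly 5 2 4 true ⟨ex56F, [1, 1]⟩)))) =
      some (Ev.increase, Ev.drop) := by
  decide

/-- … as an instance of the event predicate. [cite: CossartSchober2020, Ex. 5.6] -/
theorem ex56_drops : IotaPolyDrops 5 2 4 ⟨ex56F, [1, 1]⟩ 0 [0, 4] := by decide

/-! ## [CS20] p. 21: `s₁` depends on `u₂` — `h = y² + u₁³u₂` over `𝔽₃`: `s₁(u₁, u₂) = ∞`, and for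
`v₂ = u₂ + u₁²` (`h = y² + u₁³v₂ − u₁⁵`) `s₁(u₁, v₂) = 2` -/

/-- one vertex: `s = ∞`; the coordinate `v₂ = u₂ + u₁²` is exhibited by substituting `u₂ ↦ u₂ − u₁² = u₂ + 2u₁²`
into `u₁³u₂`: support `{(3,1), (5,0)}`, `s = 2/1`; here `β₁ = 1/2 < 1`, so `σ₁ = 1` either way.
[cite: CossartSchober2020, p. 21 (the example announced before Thm. 3.18)] -/
theorem p21_example :
    (pnums 0 [([3, 1], 1)]).s = none ∧ (pnums 0 (substClean 3 2 0 2 2 [([3, 1], 1)])).s = some (2, 1) ∧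
      sigmaQ 3 2 0 4 [([3, 1], 1)] = some (1, 1) := by
  decide

/-! ## Hauser's kangaroo path `x² + y⁷ + yz⁴`, `p = 2` [Hauser 2010, §G]: `ι_poly` node by node -/

/-- along `(chart y, 0) → (chart z, 0) → (chart y, z = 1)`: shades `5, 2, 2, 3`; `ι_poly` (scaled by 2, with σ):
`∞` (no new component) → `(4, 0, 1, 3)` (`F = y⁵ + y³z⁴`, `N = {y}`, `β = 2`, `γ = 0`, `s = 1/2`, `σ = 1`, `α = 3/2`)
→ `(5, 5, 1, 3)` (`y⁵z³ + y³z⁵`, `N = {y, z}`) → `(3, 3, ∞, 6)` (`y⁶z³ + y⁶z⁵`, `N = {y}`): at the kangaroo edge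
`β` DROPS `5/2 → 3/2` while the shade rises; and from the first blow-up on the CJS centre is a curve (`α ≥ 1`),
so [CS20] Prop. 5.7 is not engaged on this path. (computation) [cite: Hauser2010, §G] -/
theorem hauser_iotaTrace :
    iotaTrace 2 2 4 ⟨hauserF, [0, 0]⟩ hauserPath =
      [some (5, none, false), some (2, some (4, 0, some (1, 1), 3), true),
       some (2, some (5, 5, some (1, 1), 3), true), some (3, some (3, 3, none, 6), true)] := by
  decide

/-- the kangaroo edge is a drop of `ι_poly` (slot `β`). (computation) [cite: Hauser2010, §G] -/
theorem hauser_kangaroo_drops : IotaPolyDrops 2 2 4 ⟨[([5, 3], 1), ([3, 5], 1)], [3, 3]⟩ 0 [0, 1] := by decide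

/-- at the antelope `y⁵z³ + y³z⁵` the substitution `z ↦ z + y` changes nothing after cleaning (`σ_y = s_y = 1`,
certificate NR of the notes). (computation) [folklore] -/
theorem hauser_antelope_NR : substClean 2 2 0 1 1 [([5, 3], 1), ([3, 5], 1)] = [([5, 3], 1), ([3, 5], 1)] := by
  decide

/-! ## The two prescribed-history zoo rows (both new components prescribed, `r₀ ≠ 0`) -/

/-- `iso-p2-y3z+yz3-r11`: `x² + y³z + yz³ = x² + yz(y+z)²` over `𝔽₂`, `r₀ = (1,1)`, chart `y`, `z ↦ z + 1`:
shade `2 → 3`; `ι_poly` (scaled, with σ): `(3, 3, ∞, 1) → (3, 3, ∞, 2)`, an INCREASE in the slot `α` — and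
`σ_y = ∞` with `β_y ≥ 1` at the source: `z ↦ z + y` makes the cleaned `F` the monomial `yz³`, i.e. the curve
`V(x + yz, y + z)` of order 2 passes through the point, which is therefore NOT isolated in the singular locus (the
situation excluded on p. 33 of [CS20]); no conflict with Prop. 5.7; the target has `α_y = 1` (CJS curve centre).
(computation) [folklore] -/
theorem iso_p2_iota :
    iotaTrace 2 2 4 ⟨[([3, 1], 1), ([1, 3], 1)], [1, 1]⟩ [(0, [0, 1])] =
      [some (2, some (3, 3, none, 1), false), some (3, some (3, 3, none, 2), true)] ∧
    substClean 2 2 0 1 1 [([3, 1], 1), ([1, 3], 1)] = [([1, 3], 1)] := by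
  decide

/-- `iso-p3-r12`: `x³ + yz⁵ + y⁴z² = x³ + yz²(y + z)³` over `𝔽₃`, `r₀ = (1, 2)`, chart `y`, `z ↦ z + 2`: shade `3 → 4`,
`ι_poly` `(4, 4, ∞, 2) → (4, 4, ∞, 3)` (scaled by 3; the minimum is attained by the component `z`, for which
`y ↦ y − z` gives `F = y⁴z² − y³z³`, cleaned `y⁴z²`: `σ_z = ∞`, whereas `σ_y = 1`): increase in the slot `α`
(non-isolated point, curve `V(x, y + z)`; the target has `α_y = 1`, a CJS curve centre). (computation) [folklore] -/
theorem iso_p3_iota :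
    iotaTrace 3 3 4 ⟨[([1, 5], 1), ([4, 2], 1)], [1, 2]⟩ [(0, [0, 2])] =
      [some (3, some (4, 4, none, 2), false), some (4, some (4, 4, none, 3), true)] := by
  decide

/-! ## The smallest atlas witness that `ι_poly` is tied to the CJS centre -/

/-- `moh-p2-r0,2-y2+z1`: `x² + z³` with the prescribed component `V(z)` of weight 2 (`r₀ = (0, 2)`), `p = 2`:
`N = {z}`, `α_z = 3/2 ≥ 1` — CJS blows up the CURVE `V(x, z)` (the singular locus is the `y`-axis); the atlas blows
up the point (chart `y`, origin): `F' = yz³`, `N' = {y, z}`, and `ι_poly` INCREASES `(0, 0, 1, 3) → (1, 1, 1, 3)`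
(scaled by 2) while the shade stalls. (computation) [folklore] -/
theorem moh_curve_increase :
    iotaTrace 2 2 4 ⟨[([0, 3], 1)], [0, 2]⟩ [(0, [0, 0])] =
      [some (1, some (0, 0, some (1, 1), 3), true), some (1, some (1, 1, some (1, 1), 3), true)] := by
  decide

/-! ## A point-centre edge of the atlas under the hypotheses of [CS20] Prop. 5.7 -/

/-- `moh-p2-r1,1-y3+z3`: `x² + yz(y³ + z³)` over `𝔽₂`, `r₀ = (1, 1)` (both components new), `α_y = α_z = 1/2 < 1`,
the initial form `yz⁴ + y⁴z = yz(y+z)(y²+yz+z²)` has no double linear factor (isolated point: CJS blows up the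
point); chart `y`, `z ↦ z + 1` (a near point off both components): `F' = y³z + y³z⁴`, `N' = {y}`;
`ι_poly` drops `(4, 4, 1, 1) → (1, 1, 1, 3)` (scaled by 2; slot `β`: `2 → 1/2`), as Prop. 5.7 / Lemma 5.10
predict, `α'_y = δ − 1 = 3/2` ((5.5)), the shade drops `3 → 1`, and at `x'` the CJS centre is the curve `V(x', y)`
(`α'_y ≥ 1`). (computation) [cite: CossartSchober2020, Prop. 5.7, (5.5)] -/
theorem moh_point_drop :
    iotaTrace 2 2 4 ⟨[([1, 4], 1), ([4, 1], 1)], [1, 1]⟩ [(0, [0, 1])] =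
      [some (3, some (4, 4, some (1, 1), 1), false), some (1, some (1, 1, some (1, 1), 3), true)] ∧
    IotaPolyDrops 2 2 4 ⟨[([1, 4], 1), ([4, 1], 1)], [1, 1]⟩ 0 [0, 1] := by
  decide

/-! ## The chart-origin laws on these rows ([CS20] (5.4): `β' = β + α − 1` on the strict transform of `V(u_i)`;
p. 31: `α' = δ − 1`, and [CJS] Lemma 12.1 (3): `β' = γ⁻` at the origin of the `u_i`-chart) -/

/-- Hauser's second step (chart `z`, origin) seen from the component `y` (`i = 0`, on the strict transform of `V(y)`):
`(qα, qβ) = (3, 4) ↦ (3, 4 + 3 − 2) = (3, 5)`; and for the chart component `z` (`i = 1`): `qα'_z = qδ − q = 5 − 2 = 3`,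
`qβ'_z = qγ⁻_z(x) = 5` (the lowest point of the line `a + b = qδ` for the component `z` is `y⁵`). (computation) [cite: CossartSchober2020, (5.4) and p. 31] -/
theorem hauser_originLaws :
    (pnums 0 [([5, 0], 1), ([3, 4], 1)]).alphaQ = 3 ∧ (pnums 0 [([5, 0], 1), ([3, 4], 1)]).betaQ = 4 ∧
    (pnums 0 [([5, 3], 1), ([3, 5], 1)]).alphaQ = 3 ∧ (pnums 0 [([5, 3], 1), ([3, 5], 1)]).betaQ = 4 + 3 - 2 ∧
    (pnums 1 [([5, 0], 1), ([3, 4], 1)]).deltaQ = 5 ∧ (pnums 1 [([5, 0], 1), ([3, 4], 1)]).gammaLoQ = 5 ∧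
    (pnums 1 [([5, 3], 1), ([3, 5], 1)]).alphaQ = 5 - 2 ∧ (pnums 1 [([5, 3], 1), ([3, 5], 1)]).betaQ = 5 := by
  decide

/-! ## A finite `σ > s` reached by ONE point blow-up from an `x² + F` root (seed probe of the notes, shape S7-c)
The [CS20] Ex. 5.6 phenomenon — the given exceptional coordinates do not realise `σ`, and `σ` is FINITE — does not occur
on the atlas' own families, but it is produced at depth 1 from the root `x² + (z + y²)³ + y⁷` over `𝔽₂`. -/

/-- the root `(z + y²)³ + y⁷` expanded mod 2 and cleaned for `q = 2`: `z³ + y⁴z + y⁷` (`y²z²`, `y⁶` removed). [folklore] -/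
def trapRoot : Poly := [([0, 3], 1), ([4, 1], 1), ([7, 0], 1)]

/-- blow up the origin, `y`-chart origin: `F' = yz³ + y³z + y⁵` with the one new component `V(y)`; in the given
coordinates `(qβ, qγ, s, qα) = (3, 3, 2/2, 1)` with three vertices, while the root procedure (`z ↦ z + y`, giving
`yz³ + y⁵` after cleaning `y²z²`) certifies `σ_y = 4/3 > 1 = s_y`. [cite: CossartSchober2020, (5.1), Ex. 5.6 (the same mechanism)] -/
theorem trap_step :
    (step 2 2 ⟨trapRoot, [0, 0]⟩ 0 [0, 0]).map (fun s => (s.r, pnums 0 s.F, sigmaQ 2 2 0 4 s.F)) =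
      some ([1, 0], ⟨4, 1, 3, 3, 1, some (2, 2), 3⟩, some (4, 3)) := by
  decide

/-- the realising substitution at the trap node explicitly. [folklore] -/
theorem trap_subst : substClean 2 2 0 1 1 [([1, 3], 1), ([3, 1], 1), ([5, 0], 1)] = [([1, 3], 1), ([5, 0], 1)] := by
  decide

/-- `ι_poly` at the trap node with `s` resp. `σ` in the third slot: `(3, 3, 1, 1)` resp. `(3, 3, 4/3, 1)` (scaled by 2).
[cite: CossartSchober2020, Def. 5.5] -/
theorem trap_iota :
    iotaPoly 2 2 4 false ⟨[([1, 3], 1), ([3, 1], 1), ([5, 0], 1)], [1, 0]⟩ = some (3, 3, some (2, 2), 1) ∧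
    iotaPoly 2 2 4 true ⟨[([1, 3], 1), ([3, 1], 1), ([5, 0], 1)], [1, 0]⟩ = some (3, 3, some (4, 3), 1) := by
  decide

end Literature.AlgebraicGeometry.Resolution.KangarooAtlasCert
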